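import Summits.Ventures.AbcSig.Rows.Bridge
import Summits.Ventures.AbcSig.Rows.C2aL59A6eqX
import Summits.Ventures.AbcSig.Rows.C2aL59A6eqXAB

/-!
# Venture AbcSig — CELL `C2aL59A6eq`: the census statement `Rows.C2aCellRed 59 (fun a => a = 6) ∅` from the two row theorems

HONEST FRAMING. COMPUTATION cell `pub-abcsig`; CONDITIONAL theorem; no claim on ABC or any summit. Hypotheses exactly as
in `Rows/C2aL59A6eqX.lean` and `Rows/C2aL59A6eqXAB.lean`: `BS04Package` (CITED), `DataComplete …` (COMPUTED level files), `EisPackage` (CITED) and `Refines` (COMPUTED) for the M6 orbits discharged in the kernel, and the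
rows' per-orbit exclusions for BOTH family predicates (`famB`, `famAB`) as universally quantified hypotheses (CITED: the census
row's certificates). Conclusion = p1's census predicate (`Rows/Statements.lean`), all four coprime coefficient
distributions `A·B = 2^a·59^m`, reduced exponents `a < n`, `m < n` (RULING H1). GENERATED by p-lean g2 gen/make_rows.py
(after plean/make_cell_bridges.py).
-/

namespace Summit.Ventures.AbcSig

/-- Cell `C2aL59A6eq` (M6 orbits discharged in the kernel): `Rows.C2aCellRed 59 (fun a => a = 6) ∅` under the rows' hypotheses. -/
theorem xcell_C2aL59A6eq (M : NewformModel) (hP : M.BS04Package)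
    (hE : M.EisPackage)
    (hD59 : M.DataComplete 59 level59Orbits)
    (hD118 : M.DataComplete 118 level118Orbits)
    (hR_orbit_59_1 : M.Refines 59 orbit_59_1 m6X_59_1)
    (hX_orbit_118_2 : ∀ n m : ℕ, n ∈ ([11] : List ℕ) → M.Excludes 118 orbit_118_2 (famB (2 ^ 6 * 59 ^ m) n (fun _ _ => True)))
    (hX_orbit_118_2' : ∀ n m : ℕ, n ∈ ([11] : List ℕ) → M.Excludes 118 orbit_118_2 (famAB (59 ^ m) (2 ^ 6) n (fun _ _ => True))) :
    Rows.C2aCellRed 59 (fun a => a = 6) ∅ :=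
  C2aCellRed_of_rows 59 (by norm_num) (by norm_num) _ _
    (fun n hn h11 hnℓ _ a m (ha : a = 6) han hm hmn x y z h1 h2 => by
      subst ha
      exact
 xrow_C2aL59A6eq M hP hE hD59 hD118 hR_orbit_59_1 n hn h11 hnℓ m hm hmn (hX_orbit_118_2 n m) x y z h1 h2)
    (fun n hn h11 hnℓ _ a m (ha : a = 6) han hm hmn x y z h1 h2 => by
      subst ha
      exact
 xrow_C2aL59A6eqAB M hP hE hD59 hD118 hR_orbit_59_1 n hn h11 hnℓ m hm hmn (hX_orbit_118_2' n m) x y z h1 h2)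

end Summit.Ventures.AbcSig
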